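import Literature.MathematicalPhysics.QuantumLattice.QuantumSpinChessboardSubsetBounds
import Literature.MathematicalPhysics.QuantumLattice.PeierlsContourExpansion
import Literature.MathematicalPhysics.QuantumLattice.XYOrderInfraredProofs
import HarnessLib

/-!
# The Peierls–chessboard bound: `⟨P⁺ₘPₙ⁻⟩ ≤ Σ_γ ∏_{elements of γ} ⟨P_Λ⟩^{1/|Λ|}`
# (Fröhlich–Lieb 1978, §I.C–I.D, eqs. (1.30), (1.41)–(1.45))

Topic `MathematicalPhysics/QuantumLattice`. This file ASSEMBLES the two halves of Fröhlich–Lieb's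
reflection-positivity Peierls argument that the tree now has separately:

* `PeierlsContourExpansion` — FL (1.25)–(1.30):
  `Re ω(Pₘ⁺Pₙ⁻) ≤ Σ_{C} Re ω(∏_{∂_in C} P⁺ ∏_{∂_out C} P⁻)` over the connected sets `C ∋ m`,
  `n ∉ C` (their boundaries are the contours `γ`);
* `QuantumSpinBlockChessboardEstimate` / `QuantumSpinChessboardSubsetBounds` — FL (1.36)/(1.42):
  the chessboard estimate with cubes of side `b` as basic elements, for patterns living on a subset
  `D` of the cubes: `|Re⟨⨂_{c ∈ D} p_c⟩|^{N^d} ≤ ∏_{c ∈ D} Re⟨P_Λ(p_c)⟩`.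

The glue proved here (FL §I.D between (1.41) and (1.44)):

* `productOp_submatrix_comp`, `gibbsState_submatrix_comp_of_invariant` — site relabelling of product
  observables and **translation covariance of the Gibbs state** of a translation-invariant `H`
  (a contour piece living on the cubes of a SHIFTED partition `v + cubes` is moved back to the
  standard partition: FL's "the pairs can be chosen in several ways", eq. (1.43));
* `re_le_re_of_productOp_le` — **dropping factors** `0 ≤ P ≤ 1` from a product observable increases
  its expectation in a positive state (FL (1.28): `P_γ ≤ P_{γ̃}` for `γ̃ ⊆ γ`);
* `cubeUnmirror`, `cubePattern`, `cubePattern_mirroredOffset` — reading an arbitrary site pattern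
  on a cube in FL's mirrored coordinates, so that the universal projection `P_Λ(p)` of the block
  chessboard estimate (`mirroredOffset`) reproduces it;
* **`re_gibbsState_productOp_pow_le_of_supported`** — a real product observable supported on the
  cubes `v + c`, `c ∈ D`, of a shifted partition: `|Re⟨⨂ g⟩|^{N^d} ≤ ∏_{c ∈ D} Re⟨P_Λ(p_c)⟩`;
* **`re_gibbsState_contourOp_le`** — FL (1.42) for ONE contour: for any sub-selection
  `S₊ ⊆ ∂_in C`, `S₋ ⊆ ∂_out C` supported on the cubes `v + D`,
  `Re⟨∏_{∂_in C}P⁺ ∏_{∂_out C}P⁻⟩ ≤ (∏_{c ∈ D} Re⟨P_Λ(p_c)⟩)^{1/N^d}`;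
* **`peierls_chessboard_bound`** — FL (1.30) + (1.42): for every choice of selections
  `C ↦ (v_C, D_C, S₊, S₋)`,
  `Re⟨Pₘ⁺Pₙ⁻⟩ ≤ Σ_{C ∈ clusterFamily} (∏_{c ∈ D_C} Re⟨P_Λ(p_{C,c})⟩)^{1/N^d}`;
  **`peierls_chessboard_bound_pow`** — FL (1.44): if every selected cube pattern has
  `Re⟨P_Λ(p)⟩ ≤ κ^{N^d}` then `Re⟨Pₘ⁺Pₙ⁻⟩ ≤ Σ_C κ^{|D_C|}`.

Hypotheses on the state: `H` Hermitian, `-βH` reflection positive across all planes between the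
cubes (`IsRPExponent`, as in the block chessboard estimate) and `H` translation invariant;
`0 ≤ P± ≤ 1` real single-site matrices with `P⁺ + P⁻ = 1`. What is NOT here: the COUNTING of
selections (`|D_C| ≥ |∂C|/(2d b^{d-1})` by averaging over the `b^d` shifts, FL (1.43)) and of
contours (FL Thm. 1.1), and the smallness of `⟨P_Λ⟩` (FL §III) — the theorem is stated for
arbitrary given selections.

## References

* J. Fröhlich, E. H. Lieb, *Phase transitions in anisotropic lattice spin systems*, Comm. Math.
  Phys. **60** (1978) 233–267, §I.C (1.25)–(1.31), §I.D (1.35)–(1.45). [FrohlichLieb1978]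
* J. Fröhlich, R. Israel, E. H. Lieb, B. Simon, Comm. Math. Phys. **62** (1978) 1–34, Thm. 4.3.
  [FrohlichIsraelLiebSimon1978]
-/

noncomputable section

open Matrix Finset NormedSpace
open scoped Kronecker ComplexOrder MatrixOrder BigOperators
open Literature.MathematicalPhysics.QuantumLattice Literature.Probability.LatticeModels
  Literature.Barriers.CriticalPhenomena.NonGibbs

namespace Literature.MathematicalPhysics.QuantumLattice

/-! ### Site relabelling of product observables; translation covariance of Gibbs states -/

section Relabel

variable {Λ : Type*} [Fintype Λ] [DecidableEq Λ] {q : ℕ}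

omit [DecidableEq Λ] in
/-- **Relabelling a product observable**: on tensor indices `σ ↦ σ ∘ π`, `⨂_x u_x ↦ ⨂_y u_{π⁻¹ y}`
(the factor at `x` moves to `π x`; cf. `onSite_submatrix_comp`). [folklore]
[cite: FrohlichLieb1978, §I.D (1.43)] -/
theorem productOp_submatrix_comp (π : Λ ≃ Λ) (u : Λ → Matrix (Fin q) (Fin q) ℂ) :
    (productOp u).submatrix (fun σ => σ ∘ π) (fun σ => σ ∘ π) = productOp (u ∘ π.symm) := by
  ext σ τ
  simp only [submatrix_apply, productOp_apply, Function.comp_apply]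
  exact Fintype.prod_equiv π _ _ fun x => by rw [Equiv.symm_apply_apply]

/-- The Gibbs state is invariant under a unitary commuting with `H`: `⟨U O Uᴴ⟩ = ⟨O⟩`. [folklore] -/
private theorem pcbAux_gibbsState_conj_of_commute {m : Type*} [Fintype m] [DecidableEq m] (β : ℝ)
    {H U : Matrix m m ℂ} (hU : U * H = H * U) (hUU : Uᴴ * U = 1) (O : Matrix m m ℂ) :
    Matrix.gibbsState β H (U * O * Uᴴ) = Matrix.gibbsState β H O := by
  have hc : Commute (gibbsWeight β H) U := by
    have h1 : Commute (-(β : ℂ) • H) U := Commute.smul_left (show Commute H U from hU.symm) _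
    exact h1.exp_left
  rw [Matrix.gibbsState_apply, Matrix.gibbsState_apply]
  congr 1
  have e : gibbsWeight β H * (U * O * Uᴴ) = U * (gibbsWeight β H * O) * Uᴴ := by
    simp only [← Matrix.mul_assoc]
    rw [hc.eq]
  rw [e, Matrix.trace_mul_cycle, hUU, Matrix.one_mul]

/-- **Invariance of the Gibbs state under a symmetry of the index set**: if reindexing along `e`
fixes `H` then `⟨O ∘ (e × e)⟩_{β,H} = ⟨O⟩_{β,H}` (the permutation matrix of `e` is a unitary
commuting with `H`). [folklore] [cite: FrohlichLieb1978, §I.D (1.43)] -/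
theorem gibbsState_submatrix_of_invariant' {m : Type*} [Fintype m] [DecidableEq m] (β : ℝ)
    {H : Matrix m m ℂ} (e : m ≃ m) (hinv : H.submatrix e e = H) (O : Matrix m m ℂ) :
    Matrix.gibbsState β H (O.submatrix e e) = Matrix.gibbsState β H O := by
  set U : Matrix m m ℂ := e.toPEquiv.toMatrix with hU
  have hUU : Uᴴ * U = 1 := conjTranspose_toPEquiv_toMatrix_mul_self e
  have hcomm : U * H = H * U := by
    have h1 : U * H * Uᴴ = H := by rw [hU, toPEquiv_toMatrix_conj, hinv]
    calc U * H = U * H * (Uᴴ * U) := by rw [hUU, mul_one]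
      _ = U * H * Uᴴ * U := by rw [← mul_assoc]
      _ = H * U := by rw [h1]
  rw [← toPEquiv_toMatrix_conj, ← hU]
  exact pcbAux_gibbsState_conj_of_commute β hcomm hUU O

/-- **Translation / relabelling covariance of the Gibbs state of an invariant Hamiltonian**: if the
site relabelling `π` fixes `H` then `⟨O ∘ (π × π)⟩ = ⟨O⟩`. [cite: FrohlichLieb1978, §I.D (1.43)] -/
theorem gibbsState_submatrix_comp_of_invariant (β : ℝ) {H : Op Λ q} (π : Λ ≃ Λ)
    (hinv : H.submatrix (fun σ => σ ∘ π) (fun σ => σ ∘ π) = H) (O : Op Λ q) :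
    Matrix.gibbsState β H (O.submatrix (fun σ => σ ∘ π) (fun σ => σ ∘ π)) =
      Matrix.gibbsState β H O :=
  gibbsState_submatrix_of_invariant' β (Equiv.arrowCongr π.symm (Equiv.refl (Fin q))) hinv O

/-- **Dropping factors increases the expectation** (FL (1.28)): in a state `ω` that is nonnegative
on positive semidefinite matrices, if `0 ≤ u_x ≤ u'_x` for every site then
`Re ω(⨂ u) ≤ Re ω(⨂ u')`. [cite: FrohlichLieb1978, eq. (1.28)] -/
theorem re_le_re_of_productOp_le {u u' : Λ → Matrix (Fin q) (Fin q) ℂ}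
    (hu : ∀ x, (u x).PosSemidef) (hd : ∀ x, (u' x - u x).PosSemidef) (ω : Op Λ q →ₗ[ℂ] ℂ)
    (hω : ∀ X : Op Λ q, X.PosSemidef → 0 ≤ (ω X).re) :
    (ω (productOp u)).re ≤ (ω (productOp u')).re := by
  have h := hω _ (productOp_sub_productOp_posSemidef hu hd)
  rw [map_sub, Complex.sub_re] at h
  linarith

end Relabel

/-! ### Cube patterns in mirrored coordinates -/

section Cubes

variable {d : ℕ} {N b : ℕ} [NeZero N] [NeZero b] {q : ℕ}

/-- Un-mirroring inside the cube `c`: the offset whose mirror image (in the coordinates where `c`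
has odd parity) is `o`; inverse of `x ↦ mirroredOffset x` on the cube `c`.
[cite: FrohlichLieb1978, eq. (1.35)] -/
def cubeUnmirror (hN : Even N) (c : BlockIdx d N) (o : Fin d → Fin b) : Fin d → Fin b :=
  fun i => if blockParity hN c i = 0 then o i else Fin.rev (o i)

omit [NeZero N] [NeZero b] in
/-- `cubeUnmirror` is an involution. [cite: FrohlichLieb1978, eq. (1.35)] -/
theorem cubeUnmirror_cubeUnmirror (hN : Even N) (c : BlockIdx d N) (o : Fin d → Fin b) :
    cubeUnmirror hN c (cubeUnmirror hN c o) = o := by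
  funext i
  unfold cubeUnmirror
  split_ifs with h
  · rfl
  · exact Fin.rev_rev _

/-- The mirrored offset of a site is the un-mirroring of its offset in its own cube.
[cite: FrohlichLieb1978, eq. (1.35)] -/
theorem mirroredOffset_eq_cubeUnmirror (hN : Even N) (x : TorusSite d (N * b)) :
    mirroredOffset hN x = cubeUnmirror hN (blockOf N b x) (offsetOf N b x) := rfl

/-- **A site pattern read on the cube `v + c` in mirrored coordinates**: `p_c(o)` is the value of
`g` at the site of the cube `c`, shifted by `v`, whose mirrored offset is `o`.
[cite: FrohlichLieb1978, eqs. (1.35)–(1.36)] -/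
def cubePattern (hN : Even N) (v : TorusSite d (N * b))
    (g : TorusSite d (N * b) → Matrix (Fin q) (Fin q) ℂ) (c : BlockIdx d N) (o : Fin d → Fin b) :
    Matrix (Fin q) (Fin q) ℂ :=
  g (blockSite N b (c, cubeUnmirror hN c o) + v)

/-- The cube pattern reproduces `g` on the shifted cube:
`p_{block y}(mirroredOffset y) = g (y + v)`.
[cite: FrohlichLieb1978, eqs. (1.35)–(1.36)] -/
theorem cubePattern_mirroredOffset (hN : Even N) (v : TorusSite d (N * b))
    (g : TorusSite d (N * b) → Matrix (Fin q) (Fin q) ℂ) (y : TorusSite d (N * b)) :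
    cubePattern hN v g (blockOf N b y) (mirroredOffset hN y) = g (y + v) := by
  rw [cubePattern, mirroredOffset_eq_cubeUnmirror, cubeUnmirror_cubeUnmirror,
    blockSite_blockOf_offsetOf]

end Cubes

/-! ### The chessboard bound for observables supported on shifted cubes -/

section Supported

variable {d : ℕ} {N b : ℕ} [NeZero N] [NeZero b] {n : ℕ}

/-- **Chessboard bound for a real product observable supported on the cubes `v + c`, `c ∈ D`, of a
shifted partition** (translate back by `v`, then the block estimate for partial patterns):
`|Re⟨⨂ g⟩|^{N^d} ≤ ∏_{c ∈ D} Re⟨P_Λ(p_c)⟩`, `p_c` the pattern of `g` on the cube `v + c` in mirrored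
coordinates.
[cite: FrohlichLieb1978, eqs. (1.42)–(1.43)] [cite: FrohlichIsraelLiebSimon1978, Thm. 4.3] -/
theorem re_gibbsState_productOp_pow_le_of_supported [NeZero (N * b)] (hd : 0 < d) (hN : Even N)
    (hN1 : 1 < N) {β : ℝ} {H : Op (TorusSite d (N * b)) (n + 1)} (hH : H.IsHermitian)
    (hK : ∀ (i : Fin d) (k : ZMod N),
      IsRPExponent (N * b) i (blockPlane N b k) (hN.mul_right b) (-(β : ℂ) • H))
    (hT : ∀ v : TorusSite d (N * b),
      H.submatrix (fun σ => σ ∘ ⇑(Equiv.addRight v)) (fun σ => σ ∘ ⇑(Equiv.addRight v)) = H)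
    (g : TorusSite d (N * b) → Matrix (Fin (n + 1)) (Fin (n + 1)) ℂ)
    (hg : ∀ x, (g x).map (starRingEnd ℂ) = g x) (v : TorusSite d (N * b))
    (D : Finset (BlockIdx d N)) (hsupp : ∀ x, blockOf N b (x - v) ∉ D → g x = 1) :
    |(Matrix.gibbsState β H (productOp g)).re| ^ (N ^ d) ≤
      ∏ c ∈ D, (Matrix.gibbsState β H
        (productOp fun y => cubePattern hN v g c (mirroredOffset hN y))).re := by
  classical
  set π : TorusSite d (N * b) ≃ TorusSite d (N * b) := Equiv.addRight v with hπ
  -- the pattern in un-shifted coordinates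
  set g' : TorusSite d (N * b) → Matrix (Fin (n + 1)) (Fin (n + 1)) ℂ := fun y => g (y + v)
    with hg'
  have hshift : productOp g = (productOp g').submatrix (fun σ => σ ∘ π) (fun σ => σ ∘ π) := by
    rw [productOp_submatrix_comp]
    congr 1
    funext y
    simp only [Function.comp_apply, hg']
    rw [show π.symm y + v = π (π.symm y) from rfl, Equiv.apply_symm_apply]
  have hg'eq : g' = fun y =>
      if blockOf N b y ∈ D then cubePattern hN v g (blockOf N b y) (mirroredOffset hN y)
      else 1 := by
    funext y
    split_ifs with hy
    · rw [cubePattern_mirroredOffset]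
    · exact hsupp (y + v) (by rwa [add_sub_cancel_right])
  rw [hshift, gibbsState_submatrix_comp_of_invariant β π (hT v), hg'eq]
  exact chessboard_estimate_blocks_gibbs_finset hd hN hN1 hH hK (cubePattern hN v g)
    (fun c o => hg _) D id

end Supported

/-! ### One contour: FL (1.42) -/

section Contour

variable {d : ℕ} {N b : ℕ} [NeZero N] [NeZero b] {n : ℕ}

/-- The sub-selected contour pattern: `P⁺` on `S₊`, `P⁻` on `S₋`, identity elsewhere.
[cite: FrohlichLieb1978, eqs. (1.41)–(1.42)] -/
def selectedOp (Pp Pm : Matrix (Fin (n + 1)) (Fin (n + 1)) ℂ) (Sp Sm : Finset (TorusSite d (N * b)))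
    (x : TorusSite d (N * b)) : Matrix (Fin (n + 1)) (Fin (n + 1)) ℂ :=
  if x ∈ Sp then Pp else if x ∈ Sm then Pm else 1

/-- **Fröhlich–Lieb (1.42) for one contour.** Let `H` be Hermitian and translation invariant on the
torus `(ℤ/Nbℤ)^d` with `-βH` reflection positive across the planes between the cubes of side `b`,
and `0 ≤ P± ≤ 1` real single-site matrices. For a set `C` with contour observable
`∏_{∂_in C} P⁺ ∏_{∂_out C} P⁻` (`contourOp`) and ANY sub-selection `S₊ ⊆ ∂_in C`, `S₋ ⊆ ∂_out C`
supported on the cubes `v + c`, `c ∈ D`, of a shifted partition: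
`Re⟨contourOp C⟩ ≤ (∏_{c ∈ D} Re⟨P_Λ(p_c)⟩)^{1/N^d}`, `p_c` the selected pattern on the cube `v + c`
(drop the unselected factors, translate, chessboard).
[cite: FrohlichLieb1978, eqs. (1.41)–(1.43)] -/
theorem re_gibbsState_contourOp_le [NeZero (N * b)] (hd : 0 < d) (hN : Even N) (hN1 : 1 < N)
    {β : ℝ} {H : Op (TorusSite d (N * b)) (n + 1)} (hH : H.IsHermitian)
    (hK : ∀ (i : Fin d) (k : ZMod N),
      IsRPExponent (N * b) i (blockPlane N b k) (hN.mul_right b) (-(β : ℂ) • H))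
    (hT : ∀ v : TorusSite d (N * b),
      H.submatrix (fun σ => σ ∘ ⇑(Equiv.addRight v)) (fun σ => σ ∘ ⇑(Equiv.addRight v)) = H)
    {Pp Pm : Matrix (Fin (n + 1)) (Fin (n + 1)) ℂ} (hPp : Pp.PosSemidef) (hPm : Pm.PosSemidef)
    (hPp1 : (1 - Pp).PosSemidef) (hPm1 : (1 - Pm).PosSemidef)
    (hPpr : Pp.map (starRingEnd ℂ) = Pp) (hPmr : Pm.map (starRingEnd ℂ) = Pm)
    (G : SimpleGraph (TorusSite d (N * b))) (C : Finset (TorusSite d (N * b)))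
    {Sp Sm : Finset (TorusSite d (N * b))} (hSp : Sp ⊆ innerBoundary G C)
    (hSm : Sm ⊆ outerBoundary G C) (v : TorusSite d (N * b)) (D : Finset (BlockIdx d N))
    (hsupp : ∀ x ∈ Sp ∪ Sm, blockOf N b (x - v) ∈ D) :
    (Matrix.gibbsState β H (contourOp G Pp Pm C)).re ≤
      (∏ c ∈ D, (Matrix.gibbsState β H (productOp fun y =>
        cubePattern hN v (selectedOp Pp Pm Sp Sm) c (mirroredOffset hN y))).re) ^
          (((N ^ d : ℕ) : ℝ))⁻¹ := by
  classical
  haveI : Nonempty (TensorIndex (TorusSite d (N * b)) (n + 1)) := ⟨fun _ => 0⟩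
  have hin : ∀ x, x ∈ innerBoundary G C → x ∈ C := fun x hx => (mem_innerBoundary.1 hx).1
  have hout : ∀ x, x ∈ outerBoundary G C → x ∉ C := fun x hx => (mem_outerBoundary.1 hx).1
  -- Step 1: drop the unselected factors
  have hdrop : (Matrix.gibbsState β H (contourOp G Pp Pm C)).re ≤
      (Matrix.gibbsState β H (productOp (selectedOp Pp Pm Sp Sm))).re := by
    refine re_le_re_of_productOp_le (fun x => ?_) (fun x => ?_) (Matrix.gibbsState β H)
      fun X hX => (Complex.nonneg_iff.1 (Matrix.gibbsState_nonneg_of_posSemidef β hH hX)).1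
    · split_ifs
      exacts [hPp, hPm, PosSemidef.one]
    · simp only [selectedOp]
      by_cases h1 : x ∈ Sp
      · rw [if_pos h1, if_pos (hSp h1), sub_self]; exact PosSemidef.zero
      by_cases h2 : x ∈ Sm
      · have hxo := hSm h2
        rw [if_neg h1, if_pos h2, if_neg (fun h => hout x hxo (hin x h)), if_pos hxo, sub_self]
        exact PosSemidef.zero
      rw [if_neg h1, if_neg h2]
      split_ifs
      · exact hPp1
      · exact hPm1
      · rw [sub_self]; exact PosSemidef.zero
  -- Step 2: the selected observable is supported on the shifted cubes of `D`
  have hreal : ∀ x, (selectedOp Pp Pm Sp Sm x).map (starRingEnd ℂ) = selectedOp Pp Pm Sp Sm x := by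
    intro x
    simp only [selectedOp]
    split_ifs
    exacts [hPpr, hPmr, Matrix.map_one _ (map_zero _) (map_one _)]
  have hsupp' : ∀ x, blockOf N b (x - v) ∉ D → selectedOp Pp Pm Sp Sm x = 1 := by
    intro x hx
    simp only [selectedOp]
    rw [if_neg (fun h => hx (hsupp x (mem_union_left _ h))),
      if_neg (fun h => hx (hsupp x (mem_union_right _ h)))]
  have hpow := re_gibbsState_productOp_pow_le_of_supported hd hN hN1 hH hK hT
    (selectedOp Pp Pm Sp Sm) hreal v D hsupp'
  -- Step 3: take the `N^d`-th root
  have hprod : 0 ≤ ∏ c ∈ D, (Matrix.gibbsState β H (productOp fun y =>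
      cubePattern hN v (selectedOp Pp Pm Sp Sm) c (mirroredOffset hN y))).re :=
    prod_nonneg fun c _ => re_gibbsState_blockPattern_universal_nonneg hd hN hN1 hH hK _
      fun o => hreal _
  have hn : (N ^ d : ℕ) ≠ 0 := pow_ne_zero _ (NeZero.ne N)
  set r := (Matrix.gibbsState β H (productOp (selectedOp Pp Pm Sp Sm))).re
  calc (Matrix.gibbsState β H (contourOp G Pp Pm C)).re ≤ r := hdrop
    _ ≤ |r| := le_abs_self r
    _ = (|r| ^ (N ^ d)) ^ (((N ^ d : ℕ) : ℝ))⁻¹ :=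
      (Real.pow_rpow_inv_natCast (abs_nonneg r) hn).symm
    _ ≤ _ := Real.rpow_le_rpow (pow_nonneg (abs_nonneg r) _) hpow (inv_nonneg.2 (Nat.cast_nonneg _))

end Contour

/-! ### The Peierls–chessboard bound -/

section Peierls

variable {d : ℕ} {N b : ℕ} [NeZero N] [NeZero b] {n : ℕ}

/-- **The Peierls–chessboard bound (Fröhlich–Lieb (1.30) + (1.42)).** Let `H` be Hermitian and
translation invariant on the torus `(ℤ/Nbℤ)^d` with `-βH` reflection positive across the planes
between the cubes of side `b`; `0 ≤ P± ≤ 1` real single-site matrices with `P⁺ + P⁻ = 1`; `G` any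
graph on the sites and `m ≠ n`. For EVERY choice, contour by contour, of a shift `v_C`, a set of
cubes `D_C` and sub-selections `S₊(C) ⊆ ∂_in C`, `S₋(C) ⊆ ∂_out C` supported on the cubes
`v_C + D_C`:
`Re⟨Pₘ⁺Pₙ⁻⟩_{β,H} ≤ Σ_{C ∈ clusterFamily G m n} (∏_{c ∈ D_C} Re⟨P_Λ(p_{C,c})⟩)^{1/N^d}`.
[cite: FrohlichLieb1978, eqs. (1.30), (1.42), (1.44)] -/
theorem peierls_chessboard_bound [NeZero (N * b)] (hd : 0 < d) (hN : Even N) (hN1 : 1 < N)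
    {β : ℝ} {H : Op (TorusSite d (N * b)) (n + 1)} (hH : H.IsHermitian)
    (hK : ∀ (i : Fin d) (k : ZMod N),
      IsRPExponent (N * b) i (blockPlane N b k) (hN.mul_right b) (-(β : ℂ) • H))
    (hT : ∀ v : TorusSite d (N * b),
      H.submatrix (fun σ => σ ∘ ⇑(Equiv.addRight v)) (fun σ => σ ∘ ⇑(Equiv.addRight v)) = H)
    {Pp Pm : Matrix (Fin (n + 1)) (Fin (n + 1)) ℂ} (hPp : Pp.PosSemidef) (hPm : Pm.PosSemidef)
    (hsum : Pp + Pm = 1) (hPpr : Pp.map (starRingEnd ℂ) = Pp) (hPmr : Pm.map (starRingEnd ℂ) = Pm)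
    (G : SimpleGraph (TorusSite d (N * b))) {m n' : TorusSite d (N * b)} (hmn : m ≠ n')
    (v : Finset (TorusSite d (N * b)) → TorusSite d (N * b))
    (D : Finset (TorusSite d (N * b)) → Finset (BlockIdx d N))
    (Sp Sm : Finset (TorusSite d (N * b)) → Finset (TorusSite d (N * b)))
    (hSp : ∀ C ∈ clusterFamily G m n', Sp C ⊆ innerBoundary G C)
    (hSm : ∀ C ∈ clusterFamily G m n', Sm C ⊆ outerBoundary G C)
    (hsupp : ∀ C ∈ clusterFamily G m n', ∀ x ∈ Sp C ∪ Sm C, blockOf N b (x - v C) ∈ D C) :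
    (Matrix.gibbsState β H (onSite m Pp * onSite n' Pm)).re ≤
      ∑ C ∈ clusterFamily G m n', (∏ c ∈ D C, (Matrix.gibbsState β H (productOp fun y =>
        cubePattern hN (v C) (selectedOp Pp Pm (Sp C) (Sm C)) c (mirroredOffset hN y))).re) ^
          (((N ^ d : ℕ) : ℝ))⁻¹ := by
  have hPp1 : (1 - Pp).PosSemidef := by rw [← hsum, add_sub_cancel_left]; exact hPm
  have hPm1 : (1 - Pm).PosSemidef := by rw [← hsum, add_sub_cancel_right]; exact hPp
  refine (peierls_contour_bound_gibbs G hPp hPm hsum hmn β hH).trans (sum_le_sum fun C hC => ?_)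
  exact re_gibbsState_contourOp_le hd hN hN1 hH hK hT hPp hPm hPp1 hPm1 hPpr hPmr G C (hSp C hC)
    (hSm C hC) (v C) (D C) (hsupp C hC)

/-- **Fröhlich–Lieb (1.44): `Re⟨Pₘ⁺Pₙ⁻⟩ ≤ Σ_γ κ^{|γ̃|}`.** If every selected cube pattern has a
universal expectation `Re⟨P_Λ(p_{C,c})⟩ ≤ κ^{N^d}` (`κ ≥ 0`; FL: `κ = ⟨P_Λ⟩^{1/|Λ|}`, the SAME small
number for every contour piece), then `Re⟨Pₘ⁺Pₙ⁻⟩_{β,H} ≤ Σ_{C ∈ clusterFamily G m n} κ^{|D_C|}`.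
[cite: FrohlichLieb1978, eqs. (1.44)–(1.45)] -/
theorem peierls_chessboard_bound_pow [NeZero (N * b)] (hd : 0 < d) (hN : Even N) (hN1 : 1 < N)
    {β : ℝ} {H : Op (TorusSite d (N * b)) (n + 1)} (hH : H.IsHermitian)
    (hK : ∀ (i : Fin d) (k : ZMod N),
      IsRPExponent (N * b) i (blockPlane N b k) (hN.mul_right b) (-(β : ℂ) • H))
    (hT : ∀ v : TorusSite d (N * b),
      H.submatrix (fun σ => σ ∘ ⇑(Equiv.addRight v)) (fun σ => σ ∘ ⇑(Equiv.addRight v)) = H)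
    {Pp Pm : Matrix (Fin (n + 1)) (Fin (n + 1)) ℂ} (hPp : Pp.PosSemidef) (hPm : Pm.PosSemidef)
    (hsum : Pp + Pm = 1) (hPpr : Pp.map (starRingEnd ℂ) = Pp) (hPmr : Pm.map (starRingEnd ℂ) = Pm)
    (G : SimpleGraph (TorusSite d (N * b))) {m n' : TorusSite d (N * b)} (hmn : m ≠ n')
    (v : Finset (TorusSite d (N * b)) → TorusSite d (N * b))
    (D : Finset (TorusSite d (N * b)) → Finset (BlockIdx d N))
    (Sp Sm : Finset (TorusSite d (N * b)) → Finset (TorusSite d (N * b)))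
    (hSp : ∀ C ∈ clusterFamily G m n', Sp C ⊆ innerBoundary G C)
    (hSm : ∀ C ∈ clusterFamily G m n', Sm C ⊆ outerBoundary G C)
    (hsupp : ∀ C ∈ clusterFamily G m n', ∀ x ∈ Sp C ∪ Sm C, blockOf N b (x - v C) ∈ D C)
    {κ : ℝ} (hκ : 0 ≤ κ)
    (hsmall : ∀ C ∈ clusterFamily G m n', ∀ c ∈ D C, (Matrix.gibbsState β H (productOp fun y =>
      cubePattern hN (v C) (selectedOp Pp Pm (Sp C) (Sm C)) c (mirroredOffset hN y))).re ≤
        κ ^ (N ^ d)) :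
    (Matrix.gibbsState β H (onSite m Pp * onSite n' Pm)).re ≤
      ∑ C ∈ clusterFamily G m n', κ ^ (D C).card := by
  have hreal : ∀ C x, (selectedOp Pp Pm (Sp C) (Sm C) x).map (starRingEnd ℂ) =
      selectedOp Pp Pm (Sp C) (Sm C) x := by
    intro C x
    simp only [selectedOp]
    split_ifs
    exacts [hPpr, hPmr, Matrix.map_one _ (map_zero _) (map_one _)]
  refine (peierls_chessboard_bound hd hN hN1 hH hK hT hPp hPm hsum hPpr hPmr G hmn v D Sp Sm hSp hSm
    hsupp).trans (sum_le_sum fun C hC => ?_)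
  have hn : (N ^ d : ℕ) ≠ 0 := pow_ne_zero _ (NeZero.ne N)
  have h0 : ∀ c ∈ D C, 0 ≤ (Matrix.gibbsState β H (productOp fun y =>
      cubePattern hN (v C) (selectedOp Pp Pm (Sp C) (Sm C)) c (mirroredOffset hN y))).re :=
    fun c _ => re_gibbsState_blockPattern_universal_nonneg hd hN hN1 hH hK _ fun o => hreal C _
  calc (∏ c ∈ D C, (Matrix.gibbsState β H (productOp fun y =>
          cubePattern hN (v C) (selectedOp Pp Pm (Sp C) (Sm C)) c (mirroredOffset hN y))).re) ^
          (((N ^ d : ℕ) : ℝ))⁻¹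
      ≤ (∏ c ∈ D C, κ ^ (N ^ d)) ^ (((N ^ d : ℕ) : ℝ))⁻¹ :=
        Real.rpow_le_rpow (prod_nonneg h0) (prod_le_prod h0 (hsmall C hC))
          (inv_nonneg.2 (Nat.cast_nonneg _))
    _ = κ ^ (D C).card := by
        rw [prod_const, ← pow_mul, mul_comm, pow_mul,
          Real.pow_rpow_inv_natCast (pow_nonneg hκ _) hn]

end Peierls

/-! ### Translation invariance of the rotated antiferromagnets (discharging `hT`) -/

section Translation

variable {Λ : Type*} [Fintype Λ] [DecidableEq Λ] (n : ℕ)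

/-- Relabelling the rotated XY bond with field:
`xyRealBond h x y ↦ xyRealBond (h ∘ π⁻¹) (π x) (π y)`.
[cite: DLS1978, §2] -/
theorem xyRealBond_submatrix_comp (π : Λ ≃ Λ) (h : Λ → ℝ) (x y : Λ) :
    (xyRealBond n h x y : Op Λ (n + 1)).submatrix (fun σ => σ ∘ π) (fun σ => σ ∘ π) =
      xyRealBond n (h ∘ π.symm) (π x) (π y) := by
  simp only [xyRealBond, submatrix_add, submatrix_sub, submatrix_neg, submatrix_smul, Pi.add_apply,
    Pi.sub_apply, Pi.neg_apply, Pi.smul_apply, spinBond_submatrix_comp, siteSpin_submatrix_comp,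
    Matrix.submatrix_one _ (bijective_comp_equiv (q := n + 1) π).injective, Function.comp_apply,
    Equiv.symm_apply_apply]

/-- Relabelling the rotated Heisenberg bond with field. [cite: DLS1978, §2] -/
theorem heisRealBond_submatrix_comp (π : Λ ≃ Λ) (h : Λ → ℝ) (x y : Λ) :
    (heisRealBond n h x y : Op Λ (n + 1)).submatrix (fun σ => σ ∘ π) (fun σ => σ ∘ π) =
      heisRealBond n (h ∘ π.symm) (π x) (π y) := by
  rw [heisRealBond, heisRealBond, submatrix_sub, Pi.sub_apply, Pi.sub_apply,
    xyRealBond_submatrix_comp, spinBond_submatrix_comp]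

end Translation

section TranslationTorus

variable {d : ℕ} (L : ℕ) [NeZero L] (n : ℕ)

/-- A graph automorphism of the torus maps edges to edges. [folklore] -/
private theorem pcbAux_map_mem_edgeFinset (π : TorusSite d L ≃ TorusSite d L)
    (hπ : ∀ x y, (torusGraph d L).Adj (π x) (π y) ↔ (torusGraph d L).Adj x y)
    {e : Sym2 (TorusSite d L)} (he : e ∈ (torusGraph d L).edgeFinset) :
    Sym2.map π e ∈ (torusGraph d L).edgeFinset := by
  induction e using Sym2.ind with
  | h x y =>
    rw [Sym2.map_mk, SimpleGraph.mem_edgeFinset, SimpleGraph.mem_edgeSet, hπ]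
    exact (SimpleGraph.mem_edgeSet _).1 (SimpleGraph.mem_edgeFinset.1 he)

/-- **Covariance of the weighted rotated Hamiltonian** under a graph automorphism `π` of the torus
preserving the bond weights: `H♭_w(h) ∘ (π × π) = H♭_w(h ∘ π⁻¹)`. [cite: DLS1978, §2] -/
theorem heisWeightedRealFieldHamiltonian_submatrix_comp (π : TorusSite d L ≃ TorusSite d L)
    (hπ : ∀ x y, (torusGraph d L).Adj (π x) (π y) ↔ (torusGraph d L).Adj x y)
    {w : Sym2 (TorusSite d L) → ℝ} (hw : ∀ e, w (Sym2.map π e) = w e) (h : TorusSite d L → ℝ) :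
    (heisWeightedRealFieldHamiltonian L n w h).submatrix (fun σ => σ ∘ π) (fun σ => σ ∘ π) =
      heisWeightedRealFieldHamiltonian L n w (h ∘ π.symm) := by
  have hπ' : ∀ x y, (torusGraph d L).Adj (π.symm x) (π.symm y) ↔ (torusGraph d L).Adj x y :=
    fun x y => by rw [← hπ (π.symm x) (π.symm y), Equiv.apply_symm_apply, Equiv.apply_symm_apply]
  unfold heisWeightedRealFieldHamiltonian
  rw [submatrix_finset_sum]
  refine Finset.sum_nbij' (Sym2.map π) (Sym2.map π.symm) (fun e he => ?_) (fun e he => ?_)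
    (fun e _ => ?_) (fun e _ => ?_) (fun e _ => ?_)
  · exact pcbAux_map_mem_edgeFinset L π hπ he
  · exact pcbAux_map_mem_edgeFinset L π.symm hπ' he
  · simp only [Sym2.map_map, Equiv.symm_comp_self, Sym2.map_id', id_eq]
  · simp only [Sym2.map_map, Equiv.self_comp_symm, Sym2.map_id', id_eq]
  · rw [submatrix_smul, Pi.smul_apply, Pi.smul_apply, hw]
    congr 1
    induction e using Sym2.ind with
    | h x y => rw [Sym2.lift_mk, Sym2.map_mk, Sym2.lift_mk, heisRealBond_submatrix_comp]

omit [NeZero L] in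
/-- Translations are automorphisms of the torus graph. [folklore] -/
private theorem pcbAux_torusGraph_adj_add_right (v x y : TorusSite d L) :
    (torusGraph d L).Adj (x + v) (y + v) ↔ (torusGraph d L).Adj x y := by
  simp only [torusGraph_adj_iff, add_right_comm _ v, add_left_inj, ne_eq]

/-- **Translation invariance of the weighted rotated antiferromagnet without field** for
translation-invariant bond weights: `H♭_w ∘ (τ_v × τ_v) = H♭_w`. [cite: DLS1978, §2] -/
theorem heisWeightedRealFieldHamiltonian_submatrix_comp_addRight {w : Sym2 (TorusSite d L) → ℝ}
    (hw : ∀ (v : TorusSite d L) (e : Sym2 (TorusSite d L)), w (Sym2.map (Equiv.addRight v) e) = w e)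
    (v : TorusSite d L) :
    (heisWeightedRealFieldHamiltonian L n w 0).submatrix (fun σ => σ ∘ ⇑(Equiv.addRight v))
        (fun σ => σ ∘ ⇑(Equiv.addRight v)) = heisWeightedRealFieldHamiltonian L n w 0 := by
  rw [heisWeightedRealFieldHamiltonian_submatrix_comp L n (Equiv.addRight v)
    (fun x y => pcbAux_torusGraph_adj_add_right L v x y) (hw v)]
  rfl

omit [NeZero L] in
/-- The direction-dependent couplings are translation invariant. [cite: KLS1988JSP, eq. (5)] -/
theorem dirCoupling_map_addRight (K : Fin d → ℝ) (v : TorusSite d L) (e : Sym2 (TorusSite d L)) :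
    dirCoupling L K (Sym2.map (Equiv.addRight v) e) = dirCoupling L K e := by
  induction e using Sym2.ind with
  | h x y =>
    simp only [Sym2.map_mk, dirCoupling, Sym2.lift_mk, Equiv.coe_addRight, add_right_comm _ v,
      add_left_inj]

end TranslationTorus

/-! ### The antiferromagnet with direction-dependent couplings (rotated frame) -/

section Model

variable {d : ℕ} {N b : ℕ} [NeZero N] [NeZero b] (n : ℕ)

/-- **The Peierls–chessboard bound for the rotated antiferromagnet `H♭_K` with direction-dependent
couplings `K ≥ 0`** on the torus `(ℤ/Nbℤ)^d` (`N` even, `N > 1`, every spin, every `β ≥ 0`): all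
three hypotheses of `peierls_chessboard_bound_pow` — Hermiticity, reflection positivity across every
pair of planes (`heisWeightedReal_isRPExponent`) and translation invariance — hold, so for real
`0 ≤ P±`, `P⁺ + P⁻ = 1` and any selections with `Re⟨P_Λ(p)⟩ ≤ κ^{N^d}` on the selected cube
patterns:
`Re⟨Pₘ⁺Pₙ⁻⟩_{β,H♭_K} ≤ Σ_{C} κ^{|D_C|}`. [cite: FrohlichLieb1978, eqs. (1.44)–(1.45), §I.A (3)] -/
theorem heisAnisoReal_peierls_chessboard_bound_pow [NeZero (N * b)] (hd : 0 < d) (hN : Even N)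
    (hN1 : 1 < N) {K : Fin d → ℝ} (hK : ∀ i, 0 ≤ K i) {β : ℝ} (hβ : 0 ≤ β)
    {Pp Pm : Matrix (Fin (n + 1)) (Fin (n + 1)) ℂ} (hPp : Pp.PosSemidef) (hPm : Pm.PosSemidef)
    (hsum : Pp + Pm = 1) (hPpr : Pp.map (starRingEnd ℂ) = Pp) (hPmr : Pm.map (starRingEnd ℂ) = Pm)
    (G : SimpleGraph (TorusSite d (N * b))) {m n' : TorusSite d (N * b)} (hmn : m ≠ n')
    (v : Finset (TorusSite d (N * b)) → TorusSite d (N * b))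
    (D : Finset (TorusSite d (N * b)) → Finset (BlockIdx d N))
    (Sp Sm : Finset (TorusSite d (N * b)) → Finset (TorusSite d (N * b)))
    (hSp : ∀ C ∈ clusterFamily G m n', Sp C ⊆ innerBoundary G C)
    (hSm : ∀ C ∈ clusterFamily G m n', Sm C ⊆ outerBoundary G C)
    (hsupp : ∀ C ∈ clusterFamily G m n', ∀ x ∈ Sp C ∪ Sm C, blockOf N b (x - v C) ∈ D C)
    {κ : ℝ} (hκ : 0 ≤ κ)
    (hsmall : ∀ C ∈ clusterFamily G m n', ∀ c ∈ D C,
      (Matrix.gibbsState β (heisWeightedRealFieldHamiltonian (N * b) n (dirCoupling (N * b) K) 0)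
        (productOp fun y => cubePattern hN (v C) (selectedOp Pp Pm (Sp C) (Sm C)) c
          (mirroredOffset hN y))).re ≤ κ ^ (N ^ d)) :
    (Matrix.gibbsState β (heisWeightedRealFieldHamiltonian (N * b) n (dirCoupling (N * b) K) 0)
        (onSite m Pp * onSite n' Pm)).re ≤
      ∑ C ∈ clusterFamily G m n', κ ^ (D C).card :=
  peierls_chessboard_bound_pow hd hN hN1
    (heisWeightedRealFieldHamiltonian_isHermitian (N * b) n _ 0)
    (fun i k => heisWeightedReal_isRPExponent (N * b) n (hN.mul_right b) (dirCoupling_nonneg _ hK)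
      (fun j a e => dirCoupling_map_reflectBetweenSites (N * b) j a K e) hβ i (blockPlane N b k))
    (heisWeightedRealFieldHamiltonian_submatrix_comp_addRight (N * b) n
      (fun u e => dirCoupling_map_addRight (N * b) K u e))
    hPp hPm hsum hPpr hPmr G hmn v D Sp Sm hSp hSm hsupp hκ hsmall

end Model

end Literature.MathematicalPhysics.QuantumLattice

end
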